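import Summits.QuantumFields.BalabanUV.Beta.D1BFx.GhostDeficitFormula

/-!
# `BalabanUV.Beta.D1BFx.PackedDJetsGradient` — road «BF-x» for binder row D1, slot (K), junction (J3), ROUTE M of TB5-1′ ((C3) by the Ward route),
# FILE C1: **THE PACKED `D*D` GHOST JETS AT A GRADIENT WEIGHT ARE COMMUTATORS WITH THE MULTIPLICATION OPERATOR** —
# `Σ_κ wsum (grad f κ) (c•ghCur κ) = [c•(−Δ), f̂]` (summation by parts + the current's divergence) and, for the bond-diagonal table
# `diagExt ((−c)•ghX)`, `𝒲_D[w, grad f] = 𝒲_D[grad f, w] = [𝒱_D[w], f̂]` (termwise); additivity of both packings in the weight (finite support).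

WHY (journal [D1LEAF04-G22-ONLINE] ∕ [D1LEAF04-G22-INTENT-B]): with `colH K₀ = colH G₀ + grad χ` (the road's co-dressing), these identities turn the
difference of the `D*D`-only ghost words at the two weight families into the gauge slots of FILE B (`FrozenAveragingWard.hess_slot_grad ∕ hess_grad_slot`);
FILE C2 (`GhostLoopGaugeVariation`) assembles.  Commutators are written POINTWISE, `[K, f̂] = (x z ↦ (f z − f x)·K x z)` — NO definition.

CONTENT (all [folklore]; fibre `Unit`; `c : ℝ` the stencil weight, `f : Site 4 → ℝ`): `summable_mul_ghCur ∕ summable_mul_ghX` (anything times the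
current ∕ contact is summable in the stencil index: support `⊆ {x, z}`), **`packD_stencil_grad`** (bounded `f`; `CoDressedColumnPairing.sum_tsum_grad_mul_eq_neg_tsum_mul_div`
+ `GhostStencilDivergence.div_ghCur_apply`), `grad_mul_ghX_eq` (termwise: `(f(u+e_κ) − f u)·(−ghX κ u) = [ghCur κ u, f̂]`), **`packD_table_grad_right ∕ _left`**
(`GhostDeficitFormula.sum_sum_wsum_diagExt`, then termwise — no summability), **`packD_stencil_add`**, **`packD_table_add_left ∕ _right`**.

HONEST DEPENDENCY (cell records, verbatim): «continuum YM on T⁴ ⇐ BetaPertH ∧ nine spine estimates (0/9 proved); BetaPertH ⇐ (D1) ∧ (D4) ∧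
CAP+tail; G-an2-4 gates asym, D1 and NE2/3/4.»  HONEST FRAMING (cell contract, verbatim): «discharging `BetaPertH` makes Bałaban's UV stability
UNCONDITIONAL — a real constructive-QFT result; it is NOT the continuum limit and NOT the Clay problem.»  THIS MODULE DISCHARGES NOTHING of (K),
of D1 or of the wall: [folklore] summation by parts over OUR stencils.  No definition, no `def … : Prop`, nothing cited, 0 sorry.  0 root-level binders
of row D1 discharged; (J3) DISPLAYED; (K) NOT closed; NOT D1, NOT `BetaPertH`, NOT continuum, NOT Clay.
ABSOLUTE RULE (cell charter, verbatim): «No internally-minted statement may enter as a cited fact. Every hypothesis is either kernel-proved in this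
package or a verbatim quotation of a PUBLISHED theorem with page reference. The manuscript(s) under audit are NOT citable for their own disputed
steps — they are the thing under adjudication; programme-internal (2001/route/tribunal) claims are never citable.»
Unit `b2b-balaban-beta-d1-formalise-leaf-04` (gen 22), D1 formalisation swarm leaf prover 04, road «BF-x»; ROUTE M (C3) structure, FILE C1 (journal [D1LEAF04-G22-*]).
-/

noncomputable section

namespace Summit.QuantumFields.BalabanUV.Beta.D1BFx.PackedDJetsGradient

open Finset
open scoped BigOperators
open Literature.MathematicalPhysics.QuantumFieldTheory.Balaban1983to89
open Literature.MathematicalPhysics.QuantumFieldTheory.Balaban1983to89.Beta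
open B12Sec2to5 (l1)
open B6QGQLower276 (lapKer)
open ExpKernelCalculus (Site MKer)
open AffineAveraging (unitVec)
open OneStepResolventKernel (wsum)
open Summit.QuantumFields.BalabanUV.Beta.GAN24.CoDressedColumnPairing (sum_tsum_grad_mul_eq_neg_tsum_mul_div)
open Summit.QuantumFields.BalabanUV.Beta.D1BFx.GhostStencil (ghCur ghCur_apply)
open Summit.QuantumFields.BalabanUV.Beta.D1BFx.GhostStencilReflection (ghX ghX_apply add_unitVec_ne_self)
open Summit.QuantumFields.BalabanUV.Beta.D1BFx.GhostStencilDivergence (div_ghCur_apply)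
open Summit.QuantumFields.BalabanUV.Beta.D1BFx.GhostLegWard (summable_ite_point)
open Summit.QuantumFields.BalabanUV.Beta.D1BFx.ReducedKernelSandwichBlock (diagExt)
open Summit.QuantumFields.BalabanUV.Beta.D1BFx.GhostDeficitFormula (sum_sum_wsum_diagExt)

/-! ## §1 The packed `D*D` jets at a gradient weight are commutators -/

section SBP

variable (c : ℝ)

/-- [folklore] Anything times the current `ghCur κ u (x,z)` is summable in `u` (support `⊆ {z, x}`). -/
theorem summable_mul_ghCur (g : Site 4 → ℝ) (κ : Fin 4) (x z : Site 4) : Summable fun u : Site 4 => g u * ghCur κ u x z () () := by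
  refine summable_of_ne_finset_zero (s := ({z, x} : Finset (Site 4))) fun u hu => ?_
  rw [Finset.mem_insert, Finset.mem_singleton, not_or] at hu
  rw [ghCur_apply, if_neg (fun h => hu.1 h.2.symm), if_neg (fun h => hu.2 h.1.symm), sub_zero, mul_zero]

/-- [folklore] Anything times the contact `ghX κ u (x,z)` is summable in `u` (support `⊆ {z, x}`). -/
theorem summable_mul_ghX (g : Site 4 → ℝ) (κ : Fin 4) (x z : Site 4) : Summable fun u : Site 4 => g u * ghX κ u x z () () := by
  refine summable_of_ne_finset_zero (s := ({z, x} : Finset (Site 4))) fun u hu => ?_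
  rw [Finset.mem_insert, Finset.mem_singleton, not_or] at hu
  rw [ghX_apply, if_neg (fun h => hu.1 h.2.symm), if_neg (fun h => hu.2 h.1.symm), add_zero, mul_zero]

/-- [folklore] **THE `D*D` STENCIL PACKED WITH A GRADIENT WEIGHT IS THE COMMUTATOR WITH THE LAPLACIAN**: for a bounded `f`,
`Σ_κ wsum (u ↦ f(u+e_κ) − f u) (u ↦ c•ghCur κ u) = [c•lapKer, f̂]` (summation by parts `sum_tsum_grad_mul_eq_neg_tsum_mul_div` + the current's divergence
`div_ghCur_apply`). -/
theorem packD_stencil_grad {f : Site 4 → ℝ} {B : ℝ} (hf : ∀ u, |f u| ≤ B) :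
    (∑ κ : Fin 4, wsum (fun u => f (u + unitVec κ) - f u) (fun u => c • ghCur κ u))
      = fun x z (_ _ : Unit) => (f z - f x) * (c * lapKer (d := 4) x z) := by
  funext x z p q
  obtain rfl : p = () := Subsingleton.elim _ _
  obtain rfl : q = () := Subsingleton.elim _ _
  simp only [Finset.sum_apply, wsum, Pi.smul_apply, smul_eq_mul]
  rw [sum_tsum_grad_mul_eq_neg_tsum_mul_div (g := fun κ u => c * ghCur κ u x z () ()) hf (fun κ => summable_mul_ghCur (fun _ => c) κ x z)]
  have hdiv : ∀ u : Site 4, (∑ κ : Fin 4, (c * ghCur κ u x z () () - c * ghCur κ (u - unitVec κ) x z () ()))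
      = -c * (lapKer (d := 4) x u * (if z = u then 1 else 0) - (if x = u then 1 else 0) * lapKer (d := 4) u z) := by
    intro u
    rw [← div_ghCur_apply, Finset.mul_sum]
    exact Finset.sum_congr rfl fun κ _ => by ring
  simp only [hdiv]
  have hsplit : (fun u : Site 4 => f u * (-c * (lapKer (d := 4) x u * (if z = u then 1 else 0) - (if x = u then 1 else 0) * lapKer (d := 4) u z)))
      = fun u => (if u = x then c * (f x * lapKer (d := 4) x z) else 0) - (if u = z then c * (f z * lapKer (d := 4) x z) else 0) := by
    funext u
    by_cases hz : u = z
    · subst hz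
      by_cases hx : u = x
      · subst hx; simp
      · rw [if_pos rfl, if_neg hx, if_pos rfl, if_neg (Ne.symm hx)]; ring
    · rw [if_neg hz, if_neg (Ne.symm hz)]
      by_cases hx : u = x
      · subst hx; rw [if_pos rfl, if_pos rfl]; ring
      · rw [if_neg hx, if_neg (Ne.symm hx)]; ring
  rw [hsplit, (summable_ite_point x _).tsum_sub (summable_ite_point z _), tsum_ite_eq, tsum_ite_eq]
  ring

/-- [folklore] **THE GRADIENT-WEIGHTED CONTACT IS THE COMMUTED CURRENT**, termwise: `(f(u+e_κ) − f u)·(−ghX κ u)(x,z) = (f z − f x)·ghCur κ u (x,z)`. -/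
theorem grad_mul_ghX_eq (f : Site 4 → ℝ) (κ : Fin 4) (u x z : Site 4) :
    (f (u + unitVec κ) - f u) * ((-1) * ghX κ u x z () ()) = (f z - f x) * ghCur κ u x z () () := by
  rw [ghX_apply, ghCur_apply]
  have hne : u + unitVec κ ≠ u := add_unitVec_ne_self u κ
  by_cases h1 : x = u + unitVec κ ∧ z = u
  · obtain ⟨rfl, rfl⟩ := h1
    rw [if_pos ⟨rfl, rfl⟩, if_neg (fun h => hne h.1)]; ring
  · rw [if_neg h1]
    by_cases h2 : x = u ∧ z = u + unitVec κ
    · obtain ⟨rfl, rfl⟩ := h2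
      rw [if_pos ⟨rfl, rfl⟩]; ring
    · rw [if_neg h2]; ring

/-- [folklore] **THE `D*D` TABLE WITH A GRADIENT IN THE SECOND WEIGHT SLOT IS THE COMMUTATOR OF THE FIRST JET**:
`Σ_κ Σ_l wsum (w κ) (u ↦ wsum (grad f l) (diagExt ((−c)•ghX) κ u l)) = [𝒱_D[w], f̂]`, `𝒱_D[w] = Σ_κ wsum (w κ) (u ↦ c•ghCur κ u)` (termwise, no summability). -/
theorem packD_table_grad_right (w : Fin 4 → Site 4 → ℝ) (f : Site 4 → ℝ) :
    (∑ κ : Fin 4, ∑ l : Fin 4, wsum (w κ) (fun u => wsum (fun u' => f (u' + unitVec l) - f u') (diagExt (fun μ y => ((-1) * c) • ghX μ y) κ u l)))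
      = fun x z (_ _ : Unit) => (f z - f x) * (∑ κ : Fin 4, wsum (w κ) (fun u => c • ghCur κ u)) x z () () := by
  rw [sum_sum_wsum_diagExt]
  funext x z p q
  obtain rfl : p = () := Subsingleton.elim _ _
  obtain rfl : q = () := Subsingleton.elim _ _
  simp only [Finset.sum_apply, wsum, Pi.smul_apply, smul_eq_mul, Finset.mul_sum]
  refine Finset.sum_congr rfl fun κ _ => ?_
  rw [← tsum_mul_left]
  refine tsum_congr fun u => ?_
  have h := grad_mul_ghX_eq f κ u x z
  calc w κ u * ((f (u + unitVec κ) - f u) * ((-1) * c * ghX κ u x z () ()))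
      = w κ u * c * ((f (u + unitVec κ) - f u) * ((-1) * ghX κ u x z () ())) := by ring
    _ = (f z - f x) * (w κ u * (c * ghCur κ u x z () ())) := by rw [h]; ring

/-- [folklore] **… AND WITH THE GRADIENT IN THE FIRST WEIGHT SLOT** (the table is bond-diagonal):
`Σ_κ Σ_l wsum (grad f κ) (u ↦ wsum (w l) (diagExt ((−c)•ghX) κ u l)) = [𝒱_D[w], f̂]`. -/
theorem packD_table_grad_left (w : Fin 4 → Site 4 → ℝ) (f : Site 4 → ℝ) :
    (∑ κ : Fin 4, ∑ l : Fin 4, wsum (fun u => f (u + unitVec κ) - f u) (fun u => wsum (w l) (diagExt (fun μ y => ((-1) * c) • ghX μ y) κ u l)))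
      = fun x z (_ _ : Unit) => (f z - f x) * (∑ κ : Fin 4, wsum (w κ) (fun u => c • ghCur κ u)) x z () () := by
  rw [sum_sum_wsum_diagExt]
  funext x z p q
  obtain rfl : p = () := Subsingleton.elim _ _
  obtain rfl : q = () := Subsingleton.elim _ _
  simp only [Finset.sum_apply, wsum, Pi.smul_apply, smul_eq_mul, Finset.mul_sum]
  refine Finset.sum_congr rfl fun κ _ => ?_
  rw [← tsum_mul_left]
  refine tsum_congr fun u => ?_
  have h := grad_mul_ghX_eq f κ u x z
  calc (f (u + unitVec κ) - f u) * (w κ u * ((-1) * c * ghX κ u x z () ()))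
      = w κ u * c * ((f (u + unitVec κ) - f u) * ((-1) * ghX κ u x z () ())) := by ring
    _ = (f z - f x) * (w κ u * (c * ghCur κ u x z () ())) := by rw [h]; ring

/-- [folklore] ADDITIVITY OF THE PACKED `D*D` STENCIL IN THE WEIGHT (finite support: no summability hypothesis). -/
theorem packD_stencil_add (w₁ w₂ : Fin 4 → Site 4 → ℝ) :
    (∑ κ : Fin 4, wsum (fun u => w₁ κ u + w₂ κ u) (fun u => c • ghCur κ u))
      = (∑ κ : Fin 4, wsum (w₁ κ) (fun u => c • ghCur κ u)) + ∑ κ : Fin 4, wsum (w₂ κ) (fun u => c • ghCur κ u) := by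
  funext x z p q
  obtain rfl : p = () := Subsingleton.elim _ _
  obtain rfl : q = () := Subsingleton.elim _ _
  simp only [Pi.add_apply, Finset.sum_apply, wsum, Pi.smul_apply, smul_eq_mul, ← Finset.sum_add_distrib]
  refine Finset.sum_congr rfl fun κ _ => ?_
  have h1 : Summable fun u : Site 4 => w₁ κ u * (c * ghCur κ u x z () ()) :=
    (summable_mul_ghCur (fun u => w₁ κ u * c) κ x z).congr fun u => by ring
  have h2 : Summable fun u : Site 4 => w₂ κ u * (c * ghCur κ u x z () ()) :=
    (summable_mul_ghCur (fun u => w₂ κ u * c) κ x z).congr fun u => by ring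
  rw [← h1.tsum_add h2]
  exact tsum_congr fun u => by ring

/-- [folklore] ADDITIVITY OF THE PACKED `D*D` TABLE IN THE FIRST WEIGHT. -/
theorem packD_table_add_left (w₁ w₂ w' : Fin 4 → Site 4 → ℝ) :
    (∑ κ : Fin 4, ∑ l : Fin 4, wsum (fun u => w₁ κ u + w₂ κ u) (fun u => wsum (w' l) (diagExt (fun μ y => ((-1) * c) • ghX μ y) κ u l)))
      = (∑ κ : Fin 4, ∑ l : Fin 4, wsum (w₁ κ) (fun u => wsum (w' l) (diagExt (fun μ y => ((-1) * c) • ghX μ y) κ u l)))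
        + ∑ κ : Fin 4, ∑ l : Fin 4, wsum (w₂ κ) (fun u => wsum (w' l) (diagExt (fun μ y => ((-1) * c) • ghX μ y) κ u l)) := by
  rw [sum_sum_wsum_diagExt, sum_sum_wsum_diagExt, sum_sum_wsum_diagExt]
  funext x z p q
  obtain rfl : p = () := Subsingleton.elim _ _
  obtain rfl : q = () := Subsingleton.elim _ _
  simp only [Pi.add_apply, Finset.sum_apply, wsum, Pi.smul_apply, smul_eq_mul, ← Finset.sum_add_distrib]
  refine Finset.sum_congr rfl fun κ _ => ?_
  have h1 : Summable fun u : Site 4 => w₁ κ u * (w' κ u * ((-1) * c * ghX κ u x z () ())) :=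
    (summable_mul_ghX (fun u => w₁ κ u * (w' κ u * ((-1) * c))) κ x z).congr fun u => by ring
  have h2 : Summable fun u : Site 4 => w₂ κ u * (w' κ u * ((-1) * c * ghX κ u x z () ())) :=
    (summable_mul_ghX (fun u => w₂ κ u * (w' κ u * ((-1) * c))) κ x z).congr fun u => by ring
  rw [← h1.tsum_add h2]
  exact tsum_congr fun u => by ring

/-- [folklore] ADDITIVITY OF THE PACKED `D*D` TABLE IN THE SECOND WEIGHT. -/
theorem packD_table_add_right (w w₁ w₂ : Fin 4 → Site 4 → ℝ) :
    (∑ κ : Fin 4, ∑ l : Fin 4, wsum (w κ) (fun u => wsum (fun u' => w₁ l u' + w₂ l u') (diagExt (fun μ y => ((-1) * c) • ghX μ y) κ u l)))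
      = (∑ κ : Fin 4, ∑ l : Fin 4, wsum (w κ) (fun u => wsum (w₁ l) (diagExt (fun μ y => ((-1) * c) • ghX μ y) κ u l)))
        + ∑ κ : Fin 4, ∑ l : Fin 4, wsum (w κ) (fun u => wsum (w₂ l) (diagExt (fun μ y => ((-1) * c) • ghX μ y) κ u l)) := by
  rw [sum_sum_wsum_diagExt, sum_sum_wsum_diagExt, sum_sum_wsum_diagExt]
  funext x z p q
  obtain rfl : p = () := Subsingleton.elim _ _
  obtain rfl : q = () := Subsingleton.elim _ _
  simp only [Pi.add_apply, Finset.sum_apply, wsum, Pi.smul_apply, smul_eq_mul, ← Finset.sum_add_distrib]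
  refine Finset.sum_congr rfl fun κ _ => ?_
  have h1 : Summable fun u : Site 4 => w κ u * (w₁ κ u * ((-1) * c * ghX κ u x z () ())) :=
    (summable_mul_ghX (fun u => w κ u * (w₁ κ u * ((-1) * c))) κ x z).congr fun u => by ring
  have h2 : Summable fun u : Site 4 => w κ u * (w₂ κ u * ((-1) * c * ghX κ u x z () ())) :=
    (summable_mul_ghX (fun u => w κ u * (w₂ κ u * ((-1) * c))) κ x z).congr fun u => by ring
  rw [← h1.tsum_add h2]
  exact tsum_congr fun u => by ring

end SBP

end Summit.QuantumFields.BalabanUV.Beta.D1BFx.PackedDJetsGradient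

end
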